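import Summits.BirchSwinnertonDyer.BirchSwinnertonDyer.Theorems.ByReductionTypeAtTwoAdditivePotGoodPrintZhaiIrreducibleInstancesA
import Summits.BirchSwinnertonDyer.BirchSwinnertonDyer.Theorems.ByReductionTypeAtTwoAdditivePotGoodPrintFamily56b1Witness
import Summits.BirchSwinnertonDyer.Rank1Residual.P2.TransportAtTwoShuZhai
import Literature.NumberTheory.EllipticCurves.BSDRootNumberSmallConductorProofs
import Literature.NumberTheory.EllipticCurves.ModularCurveManinSemistableCoprimeFormProofs
import HarnessLib

/-!
# K4 crux `AdditiveRankZeroAtTwo` (19098), children C3″ (22617) / C2″ (22616): the SHU–ZHAI 2021 print road at the base `84a1`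
# (`E[2]`-REDUCIBLE, additive potentially good at `2` with `ord₂ j = 14` — OFF the `2`-adic `j`-window —, multiplicative at `3` and `7`)
# — file 1/2: the BASE CERTIFICATES in the kernel (the road, using the unramified-twist habitat transport of p698062, is file 2/2)

Cell `bsd-2adic`, seat `bsd-2adic-k4-w2` GEN 6 (prover, explicit unit, no kit); `--supports stmt-BirchSwinnertonDyer-22617 --as helper`
(cc C2″ 22616). Third base of Shu–Zhai's §5.2 table inside the K4 additive potentially-good habitat: `84a1 = [0,1,0,7,0]`
(`y² = x³ + x² + 7x = x(x² + x + 7)`; the table row «`84a1`: `ℚ(E[2]) = ℚ(√−3)`, `ℚ(E′[2]) = ℚ(√7)`, admissible `5, 11, 17, 23, 41, …`,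
`p = 47, 59, …`» pins the curve by its `2`-division fields: `disc(x² + x + 7) = −27`, and `E′ = [0,−2,0,−27,0]` has
`disc(x² − 2x − 27) = 112 = 4²·7`). KERNEL: `84a1` elliptic and globally minimal, ADDITIVE at `2` (`2 ∣ Δ`, `2 ∣ c₄`; `ord₂ j = 14 ≥ 0`
so potentially good — the window lemma does not apply, the twists' habitat comes from `addv_two_of_smul_quadraticTwist_of_emod_four_eq_one`
in file 2), non-CM (multiplicative at `3`), `#E(ℚ)[2] = 2` (`T = (0,0)`; only `T̃` is `2`-torsion mod `5`), the rational `2`-isogeny of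
degree `2` to `E′ = [0,−2,0,−27,0]` (Silverman's explicit isogeny; the model is already in two-torsion normal form), `#E′(ℚ)[2] = 2`
(mod `5`), `N(84a1) ∣ 2⁴·3·7 = 336 < 5000` (`f₃ = f₇ = 1`), the Heegner hypothesis for `(2N, ℚ(√−47))` (`d_K = −47`: `2`, `3`, `7`
split). Inputs BY NAME (file 2): Shu–Zhai Thm. 1.2/1.4, Creutz–Miller (bsd.S31), Agashe–Ribet–Stein Thm. 2.6, modularity. Closes nothing
at the `∀`-level; nothing booked; BSD is not proved by any of this.

References: [ShuZhai2021] Def. 1.1, Thm. 1.2, Thm. 1.4, §5.2 Table (row `84a1`); [CreutzMiller2012] Thm. 1.1; [AgasheRibetStein2006] Thm. 2.6;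
[SilvermanAEC2009] III.4 Ex. 4.5, VII.3.1, VIII.11; [BombieriGubler2006] 12.5.9; [Marcus1977] Ch. 3 Thm. 25; [Miller2011LMS] Def. 1.1.
-/

set_option autoImplicit false
set_option linter.dupNamespace false

noncomputable section

open scoped Classical

open Module NumberField WeierstrassCurve Literature.NumberTheory.EllipticCurves
  Literature.NumberTheory.EllipticCurves.ModularForms
  Literature.NumberTheory.EllipticCurves.Rank1Residual
  Literature.NumberTheory.EllipticCurves.Rank1Residual.Typed
  Literature.NumberTheory.EllipticCurves.ShuZhai2021
  Literature.NumberTheory.QuadraticFields.Quadratic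
  Literature.NumberTheory.EllipticCurves.AgasheRibetStein2006
  Summit.BirchSwinnertonDyer
  Summit.BirchSwinnertonDyer.Rank1Residual
  Summit.BirchSwinnertonDyer.Rank1Residual.X11b
  Summit.BirchSwinnertonDyer.Rank1Residual.X5.O1
  Summit.BirchSwinnertonDyer.Rank1Residual.P2
  Summit.BirchSwinnertonDyer.BirchSwinnertonDyer.Rank1Residual.IntModel
  Summit.BirchSwinnertonDyer.BirchSwinnertonDyer.Rank2Observatory
  Summit.BirchSwinnertonDyer.BirchSwinnertonDyer.Theorems

namespace Summit.BirchSwinnertonDyer.BirchSwinnertonDyer.Theorems.AddPotGoodPrint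

/-! ## §1 The base `84a1 = [0, 1, 0, 7, 0]` -/

/-- `84a1 = [0,1,0,7,0]` (`y² = x³ + x² + 7x`) is an elliptic curve (`Δ = −21168 = −2⁴·3³·7²`). [cite: CremonaAlgorithms1997, Table 1] -/
theorem isElliptic_84a1 : (⟨0, 1, 0, 7, 0⟩ : WeierstrassCurve ℚ).IsElliptic := ⟨by
  rw [isUnit_iff_ne_zero]; norm_num [WeierstrassCurve.Δ, WeierstrassCurve.b₂, WeierstrassCurve.b₄, WeierstrassCurve.b₆, WeierstrassCurve.b₈]⟩

/-- `84a1` is GLOBALLY MINIMAL (`|Δ| = 2⁴·3³·7²`). [cite: SilvermanAEC2009, VII.1 Remark 1.1] [cite: Kraus1989, Prop. 1 and Prop. 2] -/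
theorem isGloballyMinimal_84a1 : (⟨0, 1, 0, 7, 0⟩ : WeierstrassCurve ℚ).IsGloballyMinimal :=
  isGloballyMinimal_of_krausCriterion_support (0) (1) (0) (7) (0) [(2, 2, 4), (3, 1, 3), (7, 1, 2)]
    (by intro t ht; simp only [List.mem_cons, List.not_mem_nil, or_false] at ht
        rcases ht with rfl | rfl | rfl <;> norm_num)
    (by decide +kernel) (by decide +kernel)

/-- `Δ(84a1) = −21168` on the integer model. [cite: CremonaAlgorithms1997, Table 1] -/
theorem M84a1_Δ : (⟨0, 1, 0, 7, 0⟩ : WeierstrassCurve ℤ).Δ = -21168 := by decide +kernel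
/-- `c₄(84a1) = −320` on the integer model. [cite: CremonaAlgorithms1997, Table 1] -/
theorem M84a1_c₄ : (⟨0, 1, 0, 7, 0⟩ : WeierstrassCurve ℤ).c₄ = -320 := by decide +kernel

/-- The integer model of `84a1` is Cremona's. [cite: SilvermanAEC2009, VIII.8] -/
theorem intModel_84a1 :
    haveI := isElliptic_84a1; haveI := isGloballyMinimal_84a1
    integralModelInt (⟨0, 1, 0, 7, 0⟩ : WeierstrassCurve ℚ) = (⟨0, 1, 0, 7, 0⟩ : WeierstrassCurve ℤ) :=
  haveI := isElliptic_84a1; haveI := isGloballyMinimal_84a1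
  integralModelInt_eq_of_map_eq _ (by ext <;> simp [WeierstrassCurve.map])

/-- The integer equation base-changes to the rational one. [folklore] -/
theorem M84a1_map : (⟨0, 1, 0, 7, 0⟩ : WeierstrassCurve ℤ).map (Int.castRingHom ℚ) = (⟨0, 1, 0, 7, 0⟩ : WeierstrassCurve ℚ) := by
  ext <;> simp [WeierstrassCurve.map]

/-- **`ord₂ j(84a1) = 14`** (`2⁶ ∥ c₄`, `2⁴ ∥ Δ`): OFF the window `[1, 11]` but `≥ 0` (potentially good). [cite: SilvermanAEC2009, III.1 and VII.5 Prop. 5.5] -/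
theorem padicValRat_j_84a1 :
    haveI := isElliptic_84a1
    padicValRat 2 (⟨0, 1, 0, 7, 0⟩ : WeierstrassCurve ℚ).j = 14 := by
  haveI : Fact (Nat.Prime 2) := ⟨Nat.prime_two⟩
  haveI := isElliptic_84a1; haveI := isGloballyMinimal_84a1
  rw [AdditivePotMult.padicValRat_j_eq_of_intModel intModel_84a1 2 6 4 (by rw [M84a1_c₄]; decide) (by rw [M84a1_c₄]; decide)
    (by rw [M84a1_Δ]; decide) (by rw [M84a1_Δ]; decide)]
  norm_num

/-- **`84a1` is non-CM** (multiplicative at `3`: `3 ∣ Δ`, `3 ∤ c₄`, so `ord₃ j < 0`). [cite: SilvermanAEC2009, App. C §11] -/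
theorem not_hasCM_84a1 :
    haveI := isElliptic_84a1
    ¬ (⟨0, 1, 0, 7, 0⟩ : WeierstrassCurve ℚ).HasCM := by
  haveI : Fact (Nat.Prime 3) := ⟨by norm_num⟩
  haveI := isElliptic_84a1; haveI := isGloballyMinimal_84a1
  exact AdditivePotMult.not_hasCM_of_padicValRat_j_neg (p := 3) (EisensteinPrimes.padicValRat_j_neg_of_mult _ 3
    (hasMultiplicativeReductionAtPrime_of_intModel intModel_84a1 3 (by rw [M84a1_Δ]; decide) (by rw [M84a1_c₄]; decide)))

/-! ## §2 `#84a1(ℚ)[2] = 2` and `84a1[2]` reducible -/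

/-- In a group whose `2`-torsion is `{0, T}` with `T ≠ 0`, `2•T = 0`, the `2`-torsion subtype has two elements. [folklore] -/
private theorem natCard_twoTorsion_eq_two_of_subset' {A : Type*} [AddCommGroup A] {T : A} (hT0 : T ≠ 0)
    (hT2 : (2 : ℕ) • T = 0) (h : ∀ τ : A, (2 : ℤ) • τ = 0 → τ = 0 ∨ τ = T) :
    Nat.card {P : A // (2 : ℕ) • P = 0} = 2 := by
  rw [Nat.card_eq_two_iff]
  refine ⟨⟨0, smul_zero _⟩, ⟨T, hT2⟩, fun he => hT0 (Subtype.mk.inj he).symm, ?_⟩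
  ext ⟨τ, hτ⟩
  simp only [Set.mem_insert_iff, Set.mem_singleton_iff, Set.mem_univ, iff_true]
  have hτ' : (2 : ℤ) • τ = 0 := by rw [← natCast_zsmul] at hτ; exact_mod_cast hτ
  rcases h τ hτ' with rfl | rfl
  · exact Or.inl rfl
  · exact Or.inr rfl

/-- **`#84a1(ℚ)[2] = 2` — IN THE KERNEL** (Shu–Zhai's (Tor) for `E`): `x³ + x² + 7x = x(x² + x + 7)`, `T = (0, 0)`;
modulo the good prime `5` the only affine `2`-torsion point is `T̃` (`decide +kernel`), and prime-to-`3` torsion injects.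
[cite: ShuZhai2021, §1 (Tor)] [cite: SilvermanAEC2009, Prop. VII.3.1(b)] -/
theorem natCard_twoTorsion_84a1 :
    haveI := isElliptic_84a1
    Nat.card {P : (⟨0, 1, 0, 7, 0⟩ : WeierstrassCurve ℚ).toAffine.Point // (2 : ℕ) • P = 0} = 2 := by
  rw [← M84a1_map]
  haveI : Fact (Nat.Prime 5) := ⟨by norm_num⟩
  set V : WeierstrassCurve ℤ := ⟨0, 1, 0, 7, 0⟩ with hV
  have hT : (0 : ℤ) ^ 2 + V.a₁ * 0 * 0 + V.a₃ * 0 = 0 ^ 3 + V.a₂ * 0 ^ 2 + V.a₄ * 0 + V.a₆ := by simp [hV]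
  have hT2 : 2 * (0 : ℤ) + V.a₁ * 0 + V.a₃ = 0 := by simp [hV]
  have hΔ : ¬ ((5 : ℕ) : ℤ) ∣ V.Δ := by rw [hV, M84a1_Δ]; decide
  have hB : twoTorsionOnlyB V 5 0 0 = true := by rw [hV]; decide +kernel
  have h := twoTorsion_eq_zero_or_eq V hT hT2 5 hΔ (by norm_num) hB
  haveI := isElliptic_rat V (Δ_ne_zero_of_not_dvd V hΔ)
  refine natCard_twoTorsion_eq_two_of_subset' (Affine.Point.some_ne_zero _) ?_ (by exact_mod_cast h)
  exact two_nsmul_some_eq_zero V (Δ_ne_zero_of_not_dvd V hΔ) hT hT2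

/-- **`84a1[2]` is REDUCIBLE** (`T = (0, 0)` is a rational point of order `2`). [cite: SilvermanAEC2009, III.2.3] -/
theorem red_two_84a1 :
    haveI := isElliptic_84a1; haveI : Fact (Nat.Prime 2) := ⟨Nat.prime_two⟩
    Red (⟨0, 1, 0, 7, 0⟩ : WeierstrassCurve ℚ) 2 := by
  haveI : Fact (Nat.Prime 2) := ⟨Nat.prime_two⟩
  haveI := isElliptic_84a1
  intro hirr
  have h1 := card_twoTorsion_eq_one_of_irr _ hirr
  rw [natCard_twoTorsion_84a1] at h1
  exact absurd h1 (by norm_num)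

/-! ## §3 The `2`-isogeny `φ : 84a1 → E′ = [0, −2, 0, −27, 0]` of degree `2`, and `#E′(ℚ)[2] = 2` -/

/-- `84a1` is already in two-torsion normal form (`y² = x³ + x² + 7x`); the identity change of variables is kept for uniformity with the twin files. [cite: SilvermanAEC2009, III.4 Example 4.5] -/
theorem shift_84a1_eq : (⟨1, 0, 0, 0⟩ : VariableChange ℚ) • (⟨0, 1, 0, 7, 0⟩ : WeierstrassCurve ℚ) =
    (⟨0, 1, 0, 7, 0⟩ : WeierstrassCurve ℚ) := by
  ext
  · simp [variableChange_a₁]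
  · simp [variableChange_a₂]
  · simp [variableChange_a₃]
  · simp [variableChange_a₄]
  · simp [variableChange_a₆]

/-- The translate is in two-torsion normal form. [cite: SilvermanAEC2009, III.4 Example 4.5] -/
theorem isTwoTorsionNF_shift_84a1 : ((⟨1, 0, 0, 0⟩ : VariableChange ℚ) • (⟨0, 1, 0, 7, 0⟩ : WeierstrassCurve ℚ)).IsTwoTorsionNF := by
  rw [shift_84a1_eq]; exact ⟨rfl, rfl, rfl⟩

/-- **`E′ = 84a1/⟨T⟩ : y² = x³ − 2x² − 27x`** (Silverman's `Y² = X³ − 2aX² + (a² − 4b)X` with `a = 1`, `b = 7`; `Δ(E′) = 2⁸·3⁶·7`,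
a model of `84a2`). [cite: SilvermanAEC2009, III.4 Example 4.5] -/
theorem twoIsogenyCodomain_shift_84a1 :
    ((⟨1, 0, 0, 0⟩ : VariableChange ℚ) • (⟨0, 1, 0, 7, 0⟩ : WeierstrassCurve ℚ)).twoIsogenyCodomain =
      (⟨0, -2, 0, -27, 0⟩ : WeierstrassCurve ℚ) := by
  rw [shift_84a1_eq]
  ext <;> norm_num [WeierstrassCurve.twoIsogenyCodomain]

/-- **A rational `2`-isogeny `84a1 → E′` of degree `2` — IN THE KERNEL** (Silverman's `2`-isogeny of the translate precomposed
with the translation; `deg = #ker = 2` by `degree_twoIsogeny` and GEN 5's `natCard_ker_comp_toIsogeny`). The codomain is written as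
`twoIsogenyCodomain` of the translate (`= [0,−2,0,−27,0]` by `twoIsogenyCodomain_shift_84a1`).
[cite: SilvermanAEC2009, III.4 Example 4.5] [cite: ShuZhai2021, §1 (E′ = E/E[2](ℚ))] -/
theorem exists_isogeny_degree_two_84a1 :
    haveI := isElliptic_84a1
    ∃ φ : Isogeny (⟨0, 1, 0, 7, 0⟩ : WeierstrassCurve ℚ)
      (((⟨1, 0, 0, 0⟩ : VariableChange ℚ) • (⟨0, 1, 0, 7, 0⟩ : WeierstrassCurve ℚ)).twoIsogenyCodomain), φ.degree = 2 := by
  haveI := isElliptic_84a1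
  haveI := isTwoTorsionNF_shift_84a1
  refine ⟨(((⟨1, 0, 0, 0⟩ : VariableChange ℚ) • (⟨0, 1, 0, 7, 0⟩ : WeierstrassCurve ℚ)).twoIsogeny).comp
      (VariableChange.toIsogeny (⟨0, 1, 0, 7, 0⟩ : WeierstrassCurve ℚ) ⟨1, 0, 0, 0⟩), ?_⟩
  unfold Isogeny.degree
  rw [natCard_ker_comp_toIsogeny]
  exact degree_twoIsogeny _

/-- `E′ = [0,−2,0,−27,0]` is the image of its integer equation. [folklore] -/
theorem MEp84a1_map : (⟨0, -2, 0, -27, 0⟩ : WeierstrassCurve ℤ).map (Int.castRingHom ℚ) = (⟨0, -2, 0, -27, 0⟩ : WeierstrassCurve ℚ) := by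
  ext <;> simp [WeierstrassCurve.map]

/-- `Δ(E′) = 1306368 = 2⁸·3⁶·7` on the integer equation. [cite: SilvermanAEC2009, III.1] -/
theorem MEp84a1_Δ : (⟨0, -2, 0, -27, 0⟩ : WeierstrassCurve ℤ).Δ = 1306368 := by decide +kernel

/-- `E′` is an elliptic curve. [cite: SilvermanAEC2009, III.1] -/
theorem isElliptic_Ep84a1 : (⟨0, -2, 0, -27, 0⟩ : WeierstrassCurve ℚ).IsElliptic := ⟨by
  rw [isUnit_iff_ne_zero]; norm_num [WeierstrassCurve.Δ, WeierstrassCurve.b₂, WeierstrassCurve.b₄, WeierstrassCurve.b₆, WeierstrassCurve.b₈]⟩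

/-- **`#E′(ℚ)[2] = 2` — IN THE KERNEL** (Shu–Zhai's (Tor) for `E′`): `x³ − 2x² − 27x = x(x² − 2x − 27)` with `disc = 112 = 4²·7` not a
square; modulo the good prime `5` the only affine `2`-torsion point is `(0,0)`. [cite: ShuZhai2021, §1 (Tor)] [cite: SilvermanAEC2009, Prop. VII.3.1(b)] -/
theorem natCard_twoTorsion_Ep84a1 :
    haveI := isElliptic_Ep84a1
    Nat.card {P : (⟨0, -2, 0, -27, 0⟩ : WeierstrassCurve ℚ).toAffine.Point // (2 : ℕ) • P = 0} = 2 := by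
  rw [← MEp84a1_map]
  haveI : Fact (Nat.Prime 5) := ⟨by norm_num⟩
  set V : WeierstrassCurve ℤ := ⟨0, -2, 0, -27, 0⟩ with hV
  have hT : (0 : ℤ) ^ 2 + V.a₁ * 0 * 0 + V.a₃ * 0 = 0 ^ 3 + V.a₂ * 0 ^ 2 + V.a₄ * 0 + V.a₆ := by simp [hV]
  have hT2 : 2 * (0 : ℤ) + V.a₁ * 0 + V.a₃ = 0 := by simp [hV]
  have hΔ : ¬ ((5 : ℕ) : ℤ) ∣ V.Δ := by rw [hV, MEp84a1_Δ]; decide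
  have hB : twoTorsionOnlyB V 5 0 0 = true := by rw [hV]; decide +kernel
  have h := twoTorsion_eq_zero_or_eq V hT hT2 5 hΔ (by norm_num) hB
  haveI := isElliptic_rat V (Δ_ne_zero_of_not_dvd V hΔ)
  refine natCard_twoTorsion_eq_two_of_subset' (Affine.Point.some_ne_zero _) ?_ (by exact_mod_cast h)
  exact two_nsmul_some_eq_zero V (Δ_ne_zero_of_not_dvd V hΔ) hT hT2


/-! ## §4 The conductor: `N ∣ |Δ| = 21168 = 2⁴·3³·7²`, `f₃ = f₇ = 1`, so `N ∣ 2⁴·3·7 = 336 < 5000` -/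

/-- **`N(84a1) ∣ |Δ_min| = 21168 = 2⁴·3³·7²`**. [cite: SilvermanAEC2009, VIII.11 and C.16] -/
theorem conductorNorm_dvd_84a1 :
    haveI := isElliptic_84a1
    (⟨0, 1, 0, 7, 0⟩ : WeierstrassCurve ℚ).conductorNorm ℤ ∣ 21168 := by
  haveI := isElliptic_84a1; haveI := isGloballyMinimal_84a1
  have hdvd := WeierstrassCurve.conductorNorm_dvd_minimalDiscriminantNorm (⟨0, 1, 0, 7, 0⟩ : WeierstrassCurve ℚ)
    (WeierstrassCurve.finite_setOf_ordMinimalDiscriminant_ne_zero_holds _)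
  rw [WeierstrassCurve.minimalDiscriminantNorm_int_eq_natAbs_minimalDiscriminantInt_holds,
    minimalDiscriminantInt_eq intModel_84a1, M84a1_Δ] at hdvd
  exact hdvd

/-- **`f_ℓ(84a1) = 1` for `ℓ ∈ {3, 7}`** (`84a1` is multiplicative at `3` and at `7`: `ℓ ∣ Δ`, `ℓ ∤ c₄` on the `ℓ`-minimal integer equation;
Bombieri–Gubler 12.5.9(b)), read on `N` as `ord_ℓ N = 1`. [cite: BombieriGubler2006, 12.5.9(b)] -/
theorem factorization_conductorNorm_eq_one_84a1 {ℓ : ℕ} (hℓ : ℓ = 3 ∨ ℓ = 7) :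
    haveI := isElliptic_84a1
    ((⟨0, 1, 0, 7, 0⟩ : WeierstrassCurve ℚ).conductorNorm ℤ).factorization ℓ = 1 := by
  haveI := isElliptic_84a1; haveI := isGloballyMinimal_84a1
  have hbc : (⟨0, 1, 0, 7, 0⟩ : WeierstrassCurve ℤ).baseChange ℚ = (⟨0, 1, 0, 7, 0⟩ : WeierstrassCurve ℚ) := by
    ext <;> simp [WeierstrassCurve.baseChange, WeierstrassCurve.map]
  haveI hE : ((⟨0, 1, 0, 7, 0⟩ : WeierstrassCurve ℤ).baseChange ℚ).IsElliptic := by rw [hbc]; infer_instance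
  have hp : Nat.Prime ℓ := by rcases hℓ with rfl | rfl <;> norm_num
  set v : IsDedekindDomain.HeightOneSpectrum ℤ := (Rat.HeightOneSpectrum.primesEquiv (R := ℤ)).symm ⟨ℓ, hp⟩ with hv
  have hgen : Rat.HeightOneSpectrum.natGenerator v = ℓ :=
    congrArg Subtype.val ((Rat.HeightOneSpectrum.primesEquiv (R := ℤ)).apply_symm_apply ⟨ℓ, hp⟩)
  have hmin : ((⟨0, 1, 0, 7, 0⟩ : WeierstrassCurve ℤ).baseChange ℚ).IsMinimalAt v := by
    rw [hbc]; exact IsGloballyMinimal.isMinimalAt_int _ v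
  have hΔ : (Rat.HeightOneSpectrum.natGenerator v : ℤ) ∣ (⟨0, 1, 0, 7, 0⟩ : WeierstrassCurve ℤ).Δ := by
    rw [hgen, M84a1_Δ]; rcases hℓ with rfl | rfl <;> decide
  have hc₄ : ¬ (Rat.HeightOneSpectrum.natGenerator v : ℤ) ∣ (⟨0, 1, 0, 7, 0⟩ : WeierstrassCurve ℤ).c₄ := by
    rw [hgen, M84a1_c₄]; rcases hℓ with rfl | rfl <;> decide
  have h1 : ((⟨0, 1, 0, 7, 0⟩ : WeierstrassCurve ℤ).baseChange ℚ).conductorExponent v = 1 :=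
    conductorExponent_eq_one_of_dvd_Δ_of_not_dvd_c₄ hmin hΔ hc₄
  rw [hbc] at h1
  rw [show ℓ = ((⟨ℓ, hp⟩ : Nat.Primes) : ℕ) from rfl, factorization_conductorNorm_primesEquiv_symm]
  exact h1

/-- **`N(84a1) ∣ 2⁴·3·7 = 336`**, hence `N < 5000` (Creutz–Miller's range) and `N ≤ 130000` (Agashe–Ribet–Stein's); Cremona: `N = 84`,
not needed. [cite: CreutzMiller2012, Thm. 1.1] [cite: AgasheRibetStein2006, Thm. 2.6] -/
theorem conductorNorm_dvd_336_84a1 :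
    haveI := isElliptic_84a1
    (⟨0, 1, 0, 7, 0⟩ : WeierstrassCurve ℚ).conductorNorm ℤ ∣ 336 := by
  haveI := isElliptic_84a1
  set N := (⟨0, 1, 0, 7, 0⟩ : WeierstrassCurve ℚ).conductorNorm ℤ with hN
  have hN0 : N ≠ 0 := (conductorNorm_pos_holds _).ne'
  have hle := (Nat.factorization_le_iff_dvd hN0 (by norm_num : (21168 : ℕ) ≠ 0)).mpr conductorNorm_dvd_84a1
  rw [← Nat.factorization_le_iff_dvd hN0 (by norm_num : (336 : ℕ) ≠ 0)]
  intro q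
  have e21168 : (21168 : ℕ) = 2 ^ 4 * 3 ^ 3 * 7 ^ 2 := by norm_num
  have e336 : (336 : ℕ) = 2 ^ 4 * 3 ^ 1 * 7 ^ 1 := by norm_num
  by_cases hq3 : q = 3
  · subst hq3
    have : (336 : ℕ).factorization 3 = 1 := by
      rw [e336, Nat.factorization_mul (by norm_num) (by norm_num), Nat.factorization_mul (by norm_num) (by norm_num),
        Finsupp.add_apply, Finsupp.add_apply, Nat.Prime.factorization_pow Nat.prime_two, Nat.Prime.factorization_pow Nat.prime_three,
        Nat.Prime.factorization_pow (by norm_num : Nat.Prime 7)]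
      simp
    rw [this, hN, factorization_conductorNorm_eq_one_84a1 (Or.inl rfl)]
  by_cases hq7 : q = 7
  · subst hq7
    have : (336 : ℕ).factorization 7 = 1 := by
      rw [e336, Nat.factorization_mul (by norm_num) (by norm_num), Nat.factorization_mul (by norm_num) (by norm_num),
        Finsupp.add_apply, Finsupp.add_apply, Nat.Prime.factorization_pow Nat.prime_two, Nat.Prime.factorization_pow Nat.prime_three,
        Nat.Prime.factorization_pow (by norm_num : Nat.Prime 7)]
      simp
    rw [this, hN, factorization_conductorNorm_eq_one_84a1 (Or.inr rfl)]
  · have hq' := hle q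
    have e : (21168 : ℕ).factorization q = (336 : ℕ).factorization q := by
      rw [e21168, e336]
      simp only [Nat.factorization_mul (by norm_num : (2:ℕ)^4 ≠ 0) (by norm_num : (3:ℕ)^3 ≠ 0),
        Nat.factorization_mul (by norm_num : (2:ℕ)^4 * 3^3 ≠ 0) (by norm_num : (7:ℕ)^2 ≠ 0),
        Nat.factorization_mul (by norm_num : (2:ℕ)^4 ≠ 0) (by norm_num : (3:ℕ)^1 ≠ 0),
        Nat.factorization_mul (by norm_num : (2:ℕ)^4 * 3^1 ≠ 0) (by norm_num : (7:ℕ)^1 ≠ 0),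
        Finsupp.add_apply, Nat.Prime.factorization_pow Nat.prime_two, Nat.Prime.factorization_pow Nat.prime_three,
        Nat.Prime.factorization_pow (by norm_num : Nat.Prime 7), Finsupp.single_apply, if_neg (Ne.symm hq3), if_neg (Ne.symm hq7)]
    rw [← e]; exact hq'

/-- Every prime dividing `2·N(84a1)` is `2`, `3` or `7`. [cite: SilvermanAEC2009, VIII.11] -/
theorem eq_two_or_three_or_seven_of_dvd_two_mul_conductorNorm_84a1 {p : ℕ} (hp : p.Prime)
    (h : haveI := isElliptic_84a1; p ∣ 2 * (⟨0, 1, 0, 7, 0⟩ : WeierstrassCurve ℚ).conductorNorm ℤ) : p = 2 ∨ p = 3 ∨ p = 7 := by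
  haveI := isElliptic_84a1
  have h' : p ∣ 2 * 336 := dvd_trans h (mul_dvd_mul_left 2 conductorNorm_dvd_336_84a1)
  rw [show (2 * 336 : ℕ) = 2 ^ 5 * 3 * 7 by norm_num] at h'
  rcases (Nat.Prime.dvd_mul hp).mp h' with h23 | h7
  · rcases (Nat.Prime.dvd_mul hp).mp h23 with h2 | h3
    · exact Or.inl ((Nat.prime_dvd_prime_iff_eq hp Nat.prime_two).mp (hp.dvd_of_dvd_pow h2))
    · exact Or.inr (Or.inl ((Nat.prime_dvd_prime_iff_eq hp Nat.prime_three).mp h3))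
  · exact Or.inr (Or.inr ((Nat.prime_dvd_prime_iff_eq hp (by norm_num)).mp h7))

/-! ## §5 The Heegner field `K = ℚ(√−47)`: `2`, `3`, `7` split (`d_K = −47 ≡ 1 (mod 8)`, `−47 ≡ 1² (mod 3)`, `−47 ≡ 3² (mod 7)`) -/

/-- `−47` is not a rational square. [folklore] -/
theorem not_sq_eq_neg47 (q : ℚ) : q ^ 2 ≠ (-47 : ℤ) := by
  intro h; push_cast at h; nlinarith [sq_nonneg q]

/-- **In every quadratic field containing `√−47`, the primes `2`, `3` and `7` split** (`d_K = −47`; `−47 ≡ 1 (mod 8)`; `(−47/3) = (1/3) = 1`;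
`(−47/7) = (2/7) = 1` as `2 ≡ 3² (mod 7)`) — the Heegner hypothesis of Shu–Zhai for `(84a1, ℚ(√−47))`, their first listed `p` for `84a1`.
[cite: ShuZhai2021, §5.2 Table (row 84a1, p = 47)] [cite: Marcus1977, Ch. 3 Thm. 25] -/
theorem split_two_three_seven_of_sqrt_neg47 (K : Type) [Field K] [NumberField K] (h2 : Module.finrank ℚ K = 2)
    (hx : ∃ x : K, x ^ 2 = ((-47 : ℤ) : K)) :
    ((Ideal.span {(2 : ℤ)}).primesOver (𝓞 K)).ncard = 2 ∧ ((Ideal.span {(3 : ℤ)}).primesOver (𝓞 K)).ncard = 2 ∧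
      ((Ideal.span {(7 : ℤ)}).primesOver (𝓞 K)).ncard = 2 := by
  obtain ⟨x, hx⟩ := hx
  have hd : NumberField.discr K = -47 :=
    discr_eq_of_sq_eq_of_fundamental h2 ⟨by decide, by
      rw [← Int.squarefree_natAbs, show (-47 : ℤ).natAbs = 47 from rfl]
      exact (by norm_num : Nat.Prime 47).prime.squarefree, by norm_num⟩ not_sq_eq_neg47 hx
  have h3ne : ((-47 : ℤ) : ZMod 3) ≠ 0 := by decide
  have hsq3 : IsSquare ((-47 : ℤ) : ZMod 3) := ⟨1, by decide⟩
  have h7ne : ((-47 : ℤ) : ZMod 7) ≠ 0 := by decide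
  have hsq7 : IsSquare ((-47 : ℤ) : ZMod 7) := ⟨3, by decide⟩
  haveI : Fact (Nat.Prime 3) := ⟨by norm_num⟩
  haveI : Fact (Nat.Prime 7) := ⟨by norm_num⟩
  refine ⟨(ncard_primesOver_two_eq_two_iff h2).mpr (by rw [hd]; decide), ?_, ?_⟩
  · refine (ncard_primesOver_eq_two_iff_legendreSym h2 (by norm_num)).mpr ?_
    rw [hd]; exact (legendreSym.eq_one_iff 3 h3ne).mpr hsq3
  · refine (ncard_primesOver_eq_two_iff_legendreSym h2 (by norm_num)).mpr ?_
    rw [hd]; exact (legendreSym.eq_one_iff 7 h7ne).mpr hsq7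

/-- **Heegner hypotheses for `84a1` at `K = ℚ(√−47)`**: every prime dividing `N` resp. `2N` splits in `K`.
[cite: ShuZhai2021, Thm. 1.2 and Thm. 1.4 (ii)] -/
theorem allPrimesSplitInSqrt_neg47_84a1 :
    haveI := isElliptic_84a1
    AllPrimesSplitInSqrt ((⟨0, 1, 0, 7, 0⟩ : WeierstrassCurve ℚ).conductorNorm ℤ) (-(47 : ℕ) : ℤ) ∧
      AllPrimesSplitInSqrt (2 * (⟨0, 1, 0, 7, 0⟩ : WeierstrassCurve ℚ).conductorNorm ℤ) (-(47 : ℕ) : ℤ) := by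
  haveI := isElliptic_84a1
  have key : ∀ (F : Type) [Field F] [NumberField F], Module.finrank ℚ F = 2 → (∃ x : F, x ^ 2 = ((-(47 : ℕ) : ℤ) : F)) →
      SatisfiesHeegnerHypothesis (2 * (⟨0, 1, 0, 7, 0⟩ : WeierstrassCurve ℚ).conductorNorm ℤ) F := by
    intro F _ _ h2 hx
    have hx' : ∃ x : F, x ^ 2 = ((-47 : ℤ) : F) := by simpa using hx
    obtain ⟨h2s, h3s, h7s⟩ := split_two_three_seven_of_sqrt_neg47 F h2 hx'
    intro p hp hpN
    rcases eq_two_or_three_or_seven_of_dvd_two_mul_conductorNorm_84a1 hp hpN with rfl | rfl | rfl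
    · simpa using h2s
    · simpa using h3s
    · simpa using h7s
  refine ⟨Or.inr fun F _ _ h2 hx => ?_, Or.inr key⟩
  exact SatisfiesHeegnerHypothesis.of_dvd (dvd_mul_left _ 2) (key F h2 hx)

/-- `#E′(ℚ)[2] = 2` read on the codomain expression of the `2`-isogeny. [cite: ShuZhai2021, §1 (Tor)] -/
theorem natCard_twoTorsion_twoIsogenyCodomain_84a1 :
    Nat.card {P : (((⟨1, 0, 0, 0⟩ : VariableChange ℚ) • (⟨0, 1, 0, 7, 0⟩ : WeierstrassCurve ℚ)).twoIsogenyCodomain).toAffine.Point //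
      (2 : ℕ) • P = 0} = 2 := by
  rw [twoIsogenyCodomain_shift_84a1]; exact natCard_twoTorsion_Ep84a1

end Summit.BirchSwinnertonDyer.BirchSwinnertonDyer.Theorems.AddPotGoodPrint

end
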